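/-
Copyright (c) 2026. All rights reserved.
Released under Apache 2.0 license as described in the file LICENSE.
Authors: HodgeCM publication cell (pub-hodgecm), GR lane, seat GR-2 (`pub-hodgecm-own-hyp34`).
-/
import Literature.NumberTheory.GelbartRogawski1991.QuadExtSplittingCharArchTwistComplex
import Literature.NumberTheory.GelbartRogawski1991.DoubledUnitarySiegelParabolicAlgebraGen
import Literature.NumberTheory.GelbartRogawski1991.DoubledWeilRepresentationArchLagrangianGen
import Literature.NumberTheory.GelbartRogawski1991.DoubledUnitaryArchSiegelModulus
import Literature.NumberTheory.GelbartRogawski1991.LocalDoubledUnitaryResidueWitness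
import Literature.NumberTheory.Automorphic.QuadExtTotallyComplexPlaces
import HarnessLib

/-!
# The doubled Weil representation, archimedean half (II-gen): the archimedean twist `η`, general `E/F`
# with `E` totally complex

General-quadratic-extension twin (namespace `GRConstructionGen`) of `DoubledWeilRepresentationArchTwist` (CM).  For
the doubled hermitian Gram matrix `J^𝔻 = hermD` of the general splitting datum (`DoubledUnitaryGlobalSplittingDataGen`)
and a unitary Hecke character `χ` of `E` with `χ|_{𝕀_F} = ε_{E/F}` (`IsSplittingCharExt F E 1 χ`), `E` TOTALLY COMPLEX,
`F` arbitrary: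

* **`exists_archDetTwist_chiDet_gen`** — there is a CONTINUOUS character `η : H(F ⊗ ℝ) = U(J^𝔻)(E ⊗ ℝ) → ℂˣ` with,
  for every `g` whose archimedean point `(g, 1)` lies in `P_Δ(𝔸)`,
  `η(g)² · ∏_{v real} det(g_{w(v)})⁻¹ = χ(det_Δ (g,1))²`, `w(v) = placeOverReal v` (the `c`-fixed complex place of
  `E` over the real place `v` of `F`).  `η` is the product of the type-(i) twist of `QuadExtSplittingCharArchTwist`
  (`∏_{v real} det(g_{w(v)})^{(e_v+1)/2}`, GR-1) and, over the COMPLEX places `v` of `F`, of the characters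
  `χ̃_{w(v)} ∘ det_{w(v)}` of `QuadExtSplittingCharArchTwistComplex` (`w(v) = placeOverComplex v`); the identity is the
  product formula `χ(u) = ∏_w χ_w(u_w)` (`QuadExt.apply_eq_prod_archComponent_of_snd_eq_one`) regrouped over the
  places of `F` (`prod_infinitePlace_eq_prod_placesOver`, `prod_eq_prod_mul_prod`).

This is the `hη` input of `DoubledWeilRepresentationArchHalfGen.exists_isArchHalf_of_archDetTwist` (GR-2).
Topic `NumberTheory/GelbartRogawski1991`; KERNEL only: one `MonoidHom` definition and theorems; no `def … : Prop`, no
named fact, no `sorry`.  Written for the stage-1 cell `pub-hodgecm` (GR lane); nothing here is a claim of the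
manuscripts adjudicated by that cell; `HC_CM` is not touched.

## References
* S. Gelbart, J. Rogawski, Invent. Math. 105 (1991), §3.1 Prop. 3.1.1 p. 455, p. 456 (3.1.2) [GelbartRogawski1991].
* S. S. Kudla, Israel J. Math. 87 (1994), §3 [Kudla1994].
* A. Paul, J. Funct. Anal. 159 (1998), §1.2 (1.2.1)–(1.2.2) p. 389 [Paul1998].
-/

set_option autoImplicit false

noncomputable section

open scoped Classical
open scoped Matrix MatrixGroups ComplexConjugate
open NumberField NumberField.InfinitePlace IsDedekindDomain
open Literature.NumberTheory.Automorphic Literature.NumberTheory.Automorphic.UnitaryGroup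
open Literature.RepresentationTheory.HarrisKudlaSweet1996
open Literature.NumberTheory.GaloisRepresentations
open Literature.NumberTheory.QuadraticForms (ideleInfiniteComponent)

namespace Literature.NumberTheory.GelbartRogawski1991.GRConstructionGen

open UnitaryDualPair UnitaryDualPair.ArchSplitting UnitaryDualPair.ArchSplitting.QuadExt

variable (F : Type) [Field F] [NumberField F] (E : Type) [Field E] [NumberField E] [Algebra F E]
  [Algebra.IsQuadraticExtension F E]
variable (c : E ≃ₐ[F] E) {δ : E} (hcδ : c δ = -δ) (hδ : δ ≠ 0)
variable {N M n : ℕ} (e : Fin N × Fin M ≃ Fin n)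
  (TV : Matrix (Fin N) (Fin N) F) (hVd : IsUnit TV.det) (TW : Matrix (Fin M) (Fin M) F) (hWd : IsUnit TW.det)

/-! ## §1 The doubled Gram matrix -/

omit [NumberField F] [NumberField E] [Algebra.IsQuadraticExtension F E] in
/-- `J^𝔻 = hermD` IS `e₂ (T ⊕ −T) e₂ ⊗ E` for `T = gramR` (definitional). [cite: GelbartRogawski1991, §3.1 Prop. 3.1.1 p. 455 L1–2] -/
theorem hermD_eq_map_reindex_fromBlocks_gen :
    hermD F E e TV TW =
      (Matrix.reindex finSumFinEquiv finSumFinEquiv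
          (Matrix.fromBlocks (gramR F e TV TW) 0 0 (-gramR F e TV TW))).map (algebraMap F E) :=
  rfl

/-! ## §2 The twist at the complex places of `F` -/

/-- **`η_ℂ = ∏_{v complex} χ̃_{w(v)} ∘ det_{w(v)}`** — the product over the COMPLEX places `v` of `F` of the characters
`g ↦ χ_{w(v)}(σ_{w(v)}⁻¹ σ_{w(v)}(det g_{w(v)}))` (`w(v)` a chosen place of `E` over `v`).
[cite: GelbartRogawski1991, §3.1 p. 456 (3.1.2)] -/
def archTwistC (χ : HeckeCharacter E)
    (wOf : {v : InfinitePlace F // v.IsComplex} → {w : InfinitePlace E // w.IsComplex}) :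
    UnitaryGroup.arch F E c (n + n) (hermD F E e TV TW) →* ℂˣ :=
  ∏ v : {v : InfinitePlace F // v.IsComplex},
    (archComponentC E χ (wOf v)).comp (detAtC F E c (hermD F E e TV TW) (wOf v))

omit [Algebra.IsQuadraticExtension F E] in
/-- formula. [cite: GelbartRogawski1991, §3.1 p. 456 (3.1.2)] -/
theorem archTwistC_apply (χ : HeckeCharacter E)
    (wOf : {v : InfinitePlace F // v.IsComplex} → {w : InfinitePlace E // w.IsComplex})
    (g : UnitaryGroup.arch F E c (n + n) (hermD F E e TV TW)) :
    archTwistC F E c e TV TW χ wOf g =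
      ∏ v : {v : InfinitePlace F // v.IsComplex}, archComponentC E χ (wOf v) (detAtC F E c (hermD F E e TV TW) (wOf v) g) := by
  simp only [archTwistC, MonoidHom.finsetProd_apply, MonoidHom.comp_apply]

omit [Algebra.IsQuadraticExtension F E] in
/-- `η_ℂ` is continuous. [cite: GelbartRogawski1991, §3.1 p. 456 (3.1.2)] -/
theorem continuous_archTwistC (χ : HeckeCharacter E)
    (wOf : {v : InfinitePlace F // v.IsComplex} → {w : InfinitePlace E // w.IsComplex}) :
    Continuous fun g => ((archTwistC F E c e TV TW χ wOf g : ℂˣ) : ℂ) := by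
  simp only [archTwistC_apply, Units.coe_prod]
  refine continuous_finsetProd _ fun v _ => ?_
  have hdet : Continuous (detAtC F E c (hermD F E e TV TW) (wOf v)) :=
    Units.isEmbedding_val₀.continuous_iff.2 (continuous_detAtC F E c (hermD F E e TV TW) (wOf v))
  exact Units.continuous_val.comp ((continuous_archComponentC E χ (wOf v)).comp hdet)

/-! ## §3 The archimedean twist in the `chiDet` language -/

include hcδ hδ hVd hWd in
/-- **The archimedean twist of the Siegel-parabolic character of `H = U(J^𝔻)`**, `E` totally complex, `F` arbitrary:
for `χ` unitary with `χ|_{𝕀_F} = ε_{E/F}` there is a continuous `η : H(F ⊗ ℝ) → ℂˣ` such that for every `g` with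
`(g, 1) ∈ P_Δ(𝔸)`: `η(g)² · ∏_{v real} det(g_{w(v)})⁻¹ = χ(det_Δ (g,1))²`, `w(v) = placeOverReal v`
(`η = ` GR-1's type-(i) twist `×` the complex-place characters `archTwistC`; `c ≠ 1` is `galConj_ne_one_of_delta`).
[cite: GelbartRogawski1991, §3.1 Prop. 3.1.1 p. 455] [cite: Kudla1994, §3] [cite: Paul1998, §1.2 (1.2.1)–(1.2.2) p. 389 L11–29] -/
theorem exists_archDetTwist_chiDet_gen [IsTotallyComplex E] {χ : HeckeCharacter E} (hχu : χ.IsUnitary)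
    (hχ : IsSplittingCharExt F E 1 χ) :
    ∃ η : UnitaryGroup.arch F E c (n + n) (hermD F E e TV TW) →* ℂˣ,
      (Continuous fun g => ((η g : ℂˣ) : ℂ)) ∧
      ∀ g : UnitaryGroup.arch F E c (n + n) (hermD F E e TV TW),
        IsSiegelDelta F E c e TV TW (UnitaryGroup.archToAdelic F E c (n + n) (hermD F E e TV TW) g) →
          ((η g : ℂˣ) : ℂ) ^ 2 *
              ∏ v : {v : InfinitePlace F // v.IsReal},
                ((((UnitaryGroup.archAt F E c (n + n) (hermD F E e TV TW) (placeOverReal F E v)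
                    (smul_placeOverReal F E c v) (LocalSplitting.galConj_ne_one_of_delta F E c hcδ hδ) g :
                    UnitaryGroup.archLocal E (n + n) (hermD F E e TV TW) (placeOverReal F E v)) :
                    GL (Fin (n + n)) ℂ) : Matrix (Fin (n + n)) (Fin (n + n)) ℂ).det)⁻¹ =
            ((chiDet F E c e TV TW χ (UnitaryGroup.archToAdelic F E c (n + n) (hermD F E e TV TW) g) : ℂˣ) : ℂ) ^ 2 := by
  have hcc : c * c = 1 := AlgEquiv.ext (LocalSplitting.galConj_apply_apply F E c hcδ hδ)
  obtain ⟨η₁, hη₁c, hη₁⟩ := hχ.exists_archDetTwist_doubled F E c (LocalSplitting.galConj_ne_one_of_delta F E c hcδ hδ) hcδ hδ (placeOverReal F E)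
    (smul_placeOverReal F E c) (gramR F e TV TW) (isUnit_det_gramR₀ F e TV hVd TW hWd) (hermD F E e TV TW)
    (hermD_eq_map_reindex_fromBlocks_gen F E e TV TW) hχu
  refine ⟨η₁ * archTwistC F E c e TV TW χ (placeOverComplex F E), ?_, fun g hS => ?_⟩
  · have h : (fun g => (((η₁ * archTwistC F E c e TV TW χ (placeOverComplex F E)) g : ℂˣ) : ℂ)) =
        fun g => ((η₁ g : ℂˣ) : ℂ) * ((archTwistC F E c e TV TW χ (placeOverComplex F E) g : ℂˣ) : ℂ) :=
      funext fun g => by rw [MonoidHom.mul_apply, Units.val_mul]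
    rw [h]
    exact hη₁c.mul (continuous_archTwistC F E c e TV TW χ (placeOverComplex F E))
  have hu := isUnit_detDelta_of_isSiegelDelta F E c e TV TW _ hS
  have hu2 : (((hu.unit : ideleGroup E) : AdeleRing (𝓞 E) E)).2 = 1 := by
    rw [hu.unit_spec]
    exact snd_det_deltaBlock_archToAdelic F E c (hermD F E e TV TW) g
  -- `χ(det_Δ) = (∏_{v real} χ_{w(v)}(u_{w(v)})) · (∏_{v complex} χ̃_{w(v)}(det_{w(v)} g))`
  have hreal : ∀ v : {v : InfinitePlace F // v.IsReal},
      ∏ w' : InfPlacesOver E v.1, χ.archComponent w'.1 (ideleInfiniteComponent E w'.1 hu.unit) =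
        χ.archComponent (placeOverReal F E v).1 (ideleInfiniteComponent E (placeOverReal F E v).1 hu.unit) := by
    intro v
    have huniv : (Finset.univ : Finset (InfPlacesOver E v.1)) =
        {⟨(placeOverReal F E v).1, placeOverReal_comap F E v⟩} := by
      ext w'
      simp only [Finset.mem_univ, Finset.mem_singleton, true_iff]
      exact Subtype.ext (QuadExt.eq_of_comap_eq_of_smul_eq F E c (placeOverReal F E v) (smul_placeOverReal F E c v) (LocalSplitting.galConj_ne_one_of_delta F E c hcδ hδ)
        w'.1 (w'.2.trans (placeOverReal_comap F E v).symm))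
    rw [huniv, Finset.prod_singleton]
  have hcx : ∀ v : {v : InfinitePlace F // v.IsComplex},
      ∏ w' : InfPlacesOver E v.1, χ.archComponent w'.1 (ideleInfiniteComponent E w'.1 hu.unit) =
        archComponentC E χ (placeOverComplex F E v) (detAtC F E c (hermD F E e TV TW) (placeOverComplex F E v) g) :=
    fun v => prod_archComponent_placesOver_eq_archComponentC_detAtC F E c v (placeOverComplex F E v)
      (placeOverComplex_comap F E v) (gramR F e TV TW) (isUnit_det_gramR₀ F e TV hVd TW hWd) (hermD F E e TV TW)
      (hermD_eq_map_reindex_fromBlocks_gen F E e TV TW) (LocalSplitting.galConj_ne_one_of_delta F E c hcδ hδ) hcc hχ g hu.unit hS hu.unit_spec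
  have hχdet : ((chiDet F E c e TV TW χ (UnitaryGroup.archToAdelic F E c (n + n) (hermD F E e TV TW) g) : ℂˣ) : ℂ) =
      (∏ v : {v : InfinitePlace F // v.IsReal},
          ((χ.archComponent (placeOverReal F E v).1 (ideleInfiniteComponent E (placeOverReal F E v).1 hu.unit) : ℂˣ) : ℂ)) *
        ((archTwistC F E c e TV TW χ (placeOverComplex F E) g : ℂˣ) : ℂ) := by
    simp only [chiDet, dif_pos hu]
    rw [QuadExt.apply_eq_prod_archComponent_of_snd_eq_one E χ hu.unit hu2,
      QuadExt.prod_infinitePlace_eq_prod_placesOver F E, prod_eq_prod_mul_prod, Units.val_mul, Units.coe_prod,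
      Units.coe_prod, archTwistC_apply, Units.coe_prod]
    congr 1
    · exact Finset.prod_congr rfl fun v _ => by rw [hreal v]
    · exact Finset.prod_congr rfl fun v _ => by rw [hcx v]
  -- the type-(i) identity (GR-1) and the final algebra
  have h1 := hη₁ g hu.unit hS hu.unit_spec
  rw [Finset.prod_pow] at h1
  rw [MonoidHom.mul_apply, Units.val_mul, hχdet]
  linear_combination ((archTwistC F E c e TV TW χ (placeOverComplex F E) g : ℂˣ) : ℂ) ^ 2 * h1

end Literature.NumberTheory.GelbartRogawski1991.GRConstructionGen

end
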